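import Summits.BirchSwinnertonDyer.BirchSwinnertonDyer.Theorems.GenusKolyvaginAtTwoShaCardDvdPowAtTwoPosTRegularSignedChebotarev
import Summits.BirchSwinnertonDyer.BirchSwinnertonDyer.Theorems.GenusKolyvaginAtTwoPowDvdShaCardAtTwoRTFullOrderPairChebotarev
import HarnessLib

/-!
# Route `GenusKolyvaginAtTwo`, U⁺_T `ShaCardDvdPowAtTwoPosT` (stmt-BirchSwinnertonDyer-23378, Δ > 0) — PART C of the regular SIGNED Čebotarev:
# THE FULL-ORDER SIGNED PAIR AT A REGULAR KOLYVAGIN PRIME (no independence hypothesis: the socle split)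

Seat `bsd-line-gk2-p4` g23 (WIDTH-5 attach, cell `bsd-f1-sign2`), `--supports stmt-BirchSwinnertonDyer-23378 --as helper`.
THEOREMS ONLY (no definition, no named fact, no `sorry`).  BSD is NOT proved by any of this; U⁺_T / Q4_T are NOT claimed; nothing is closed.

WHAT.  `exists_regular_kolyvaginPrime_fullOrder_signedPair_of_heegner` — the statement consumed as `hPair` by gk2-p5 g31's B2Q±-FRAME
(`Theorems/…PosTSharpExponentRatOfRegularPairSupply.lean`): on the GK2 / Heegner frame (`E/ℚ` globally minimal, `K` imaginary quadratic with odd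
`d_K` and the Heegner hypothesis, `ρ_{E,2}` and `ρ_{E,2^{n+1}}` onto, `c₀` a complex conjugation, `c ≠ 1`), for two EIGENCLASSES
`x, y ∈ H¹(K, E[2^{n+1}])` of orders `2^m, 2^κ` (`m, κ ≥ 1`) and signs `σ_* x = s_x x`, `σ_* y = s_y y` (`s = ±1`, ANY combination — the B2Q pair
is `(res s, c_M(1))` with `(+1, −1)`) satisfying only the SEPARATION hypothesis on `⟨x, y⟩` (from (NPh)): a regular `h = c₀ · res ρ` (involution on
`E[2^{n+1}]`, `μ`-inverting, lossless for both signs) and beyond every bound a prime `ℓ ∤ 2 N d_K`, `(ℓ)` inert in `K`, an arithmetic Frobenius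
acting on `E[2^{n+1}]` as `h` and on `K` as `c₀`, `2^{n+1} ∣ ℓ + 1`, `2^{n+1} ∣ a_ℓ`, with FULL local orders in the iff-currency
`2^j·x ∈ torsionLocalKer_λ ⟺ m ≤ j`, `2^j·y ∈ torsionLocalKer_λ ⟺ κ ≤ j`.  Proof = gk2-p2's socle split (`…RTFullOrderPairChebotarev`:
distinct socles ⟹ `{x, y}` independent ⟹ Part B with `r = 2`; common socle ⟹ Part B with `r = 1` on `x`, and the common socle, non-zero at `λ`,
transports full order to `y`) over Part B `exists_regular_kolyvaginPrime_of_heegner_signed`.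

References: [McCallumLMS1991] §3 Cor. 3.2, §5 Prop. 5.2 (proof, (11)–(13)); [GrossLMS1991] §3 (3.1)–(3.3), §9 Prop. 9.3.
-/

set_option autoImplicit false
-- the Theorems namespace of this sub repeats the summit name by design (D-0017 nested layout)
set_option linter.dupNamespace false

noncomputable section

namespace Summit.BirchSwinnertonDyer.BirchSwinnertonDyer.Theorems.GenusExact.RegularSigned

open scoped Classical
open WeierstrassCurve NumberField IsDedekindDomain Field
open Literature.NumberTheory.GaloisRepresentations Literature.NumberTheory.EllipticCurves
open Literature.NumberTheory
open Rat.HeightOneSpectrum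
open Summit.BirchSwinnertonDyer.BirchSwinnertonDyer.Theorems
open Summit.BirchSwinnertonDyer.BirchSwinnertonDyer.Theorems.GenusExact.PlusDescent

universe u

variable {K : Type u} [Field K] [NumberField K]

omit [NumberField K] in
/-- The exponent of a class of `H¹(K, E[2^{n+1}])` of order `2^m` is at most `n + 1`. [folklore] -/
theorem le_of_addOrderOf_galH1Torsion_eq_two_pow (V : WeierstrassCurve K) {n m : ℕ}
    {x : galH1Torsion V ((2 ^ (n + 1) : ℕ) : ℤ)} (hx : addOrderOf x = 2 ^ m) : m ≤ n + 1 := by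
  have h0 : ((2 ^ (n + 1) : ℕ) : ℤ) • x = 0 := zsmul_discreteH1_torsion _ x
  have hdvd : addOrderOf x ∣ 2 ^ (n + 1) := by
    have := addOrderOf_dvd_iff_zsmul_eq_zero.mpr h0
    exact_mod_cast this
  rw [hx] at hdvd
  exact (Nat.pow_dvd_pow_iff_le_right (by norm_num)).mp hdvd

/-- From the engine's output currency (`2^N·x ∈ T`, `2^{N−1}·x ∉ T`) at `N = m = ord₂ x` to the iff-currency `2^j·x ∈ T ⟺ m ≤ j`.
[folklore] -/
theorem pow_zsmul_mem_iff_of_output {V : Type*} [AddCommGroup V] (T : AddSubgroup V) {x : V} {m : ℕ} (hm : 1 ≤ m)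
    (hx : addOrderOf x = 2 ^ m) (hout : ((2 : ℤ) ^ m) • x ∈ T ∧ (m ≠ 0 → ((2 : ℤ) ^ (m - 1)) • x ∉ T)) (j : ℕ) :
    (((2 ^ j : ℕ) : ℤ)) • x ∈ T ↔ m ≤ j := by
  refine pow_zsmul_mem_iff_of_socle_not_mem T hm hx ?_ j
  rw [Nat.cast_pow, Nat.cast_ofNat]
  exact hout.2 (by omega)

variable {W : WeierstrassCurve ℚ}

/-- **THE FULL-ORDER SIGNED PAIR AT A REGULAR KOLYVAGIN PRIME** (the `hPair` input of the B2Q±-frame; see the module docstring).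
[cite: McCallumLMS1991, §3 Cor. 3.2; §5 Prop. 5.2 (proof, (11)–(13))] [cite: GrossLMS1991, §3 (3.1)–(3.3), §9 Prop. 9.3] -/
theorem exists_regular_kolyvaginPrime_fullOrder_signedPair_of_heegner (hCheb : Automorphic.chebotarev_artinRep) {N : ℕ}
    [NeZero N] [W.IsElliptic] [W.IsGloballyMinimal] (hK : IsImaginaryQuadratic K)
    (hodd : Odd (NumberField.discr K)) (hH : SatisfiesHeegnerHypothesis (W.conductorNorm ℤ) K) (n : ℕ)
    (hρ2 : W.HasSurjectiveModNGaloisRep 2) (hsurj : W.HasSurjectiveModNGaloisRep ((2 ^ (n + 1) : ℕ) : ℤ))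
    {c₀ : absoluteGaloisGroup ℚ} (hc₀ : IsComplexConjugation (Rat.castHom ℝ) c₀)
    {c : K ≃ₐ[ℚ] K} (hc : c ≠ 1)
    (x y : galH1Torsion (W.baseChange K) ((2 ^ (n + 1) : ℕ) : ℤ))
    {m κ : ℕ} (hm : 1 ≤ m) (hκ : 1 ≤ κ) (hx : addOrderOf x = 2 ^ m) (hy : addOrderOf y = 2 ^ κ)
    {sx sy : ℤ} (hsx : sx = 1 ∨ sx = -1) (hsy : sy = 1 ∨ sy = -1)
    (hτx : conjAct W c ((2 ^ (n + 1) : ℕ) : ℤ) x = sx • x) (hτy : conjAct W c ((2 ^ (n + 1) : ℕ) : ℤ) y = sy • y)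
    (hres : ∀ a b : ℤ, (∀ ρ ∈ torsionFixing (W.baseChange K) ((2 ^ (n + 1) : ℕ) : ℤ),
      h1Eval (W.baseChange K) ((2 ^ (n + 1) : ℕ) : ℤ) (a • x + b • y) ρ = 0) → a • x + b • y = 0)
    (b : ℕ) :
    ∃ ρ : absoluteGaloisGroup K,
      (∀ X : geomTorsion W ((2 ^ (n + 1) : ℕ) : ℤ),
        (c₀ * absGaloisRestrict ℚ K ρ) • (c₀ * absGaloisRestrict ℚ K ρ) • X = X) ∧
      (∀ ζ : AlgebraicClosure ℚ, ζ ^ (2 ^ (n + 1)) = 1 → (c₀ * absGaloisRestrict ℚ K ρ) • ζ = ζ⁻¹) ∧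
      (∃ P : geomTorsion W ((2 ^ (n + 1) : ℕ) : ℤ),
        (2 : ℤ) ^ n • (P + (c₀ * absGaloisRestrict ℚ K ρ) • P) ≠ 0 ∧
        (2 : ℤ) ^ n • (P - (c₀ * absGaloisRestrict ℚ K ρ) • P) ≠ 0) ∧
      ∃ ℓ : ℕ, b < ℓ ∧ ℓ.Prime ∧ ¬ ℓ ∣ N ∧ ¬ ((ℓ : ℤ) ∣ NumberField.discr K) ∧ ℓ ≠ 2 ∧
        (Ideal.span {(ℓ : 𝓞 K)}).IsPrime ∧
        (∃ (v : HeightOneSpectrum (𝓞 ℚ)) (𝔓 : Ideal (absIntegers (𝓞 ℚ) ℚ)) (h : absoluteGaloisGroup ℚ),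
          (ℓ : 𝓞 ℚ) ∈ v.asIdeal ∧ 𝔓 ∈ v.primesAbove ∧ IsArithFrobAt (𝓞 ℚ) h 𝔓 ∧
          (∀ P : geomTorsion W ((2 ^ (n + 1) : ℕ) : ℤ), h • P = (c₀ * absGaloisRestrict ℚ K ρ) • P) ∧
          ∀ (e : K →ₐ[ℚ] AlgebraicClosure ℚ) (z : K), h • e z = c₀ • e z) ∧
        2 ^ (n + 1) ∣ ℓ + 1 ∧ ((2 : ℤ) ^ (n + 1)) ∣ W.frobeniusTrace ℓ ∧
        ∀ v : HeightOneSpectrum (𝓞 K), (ℓ : 𝓞 K) ∈ v.asIdeal →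
          (∀ j : ℕ, ((2 ^ j : ℕ) : ℤ) • x ∈
              (W.baseChange K).torsionLocalKer (v.adicCompletion K) ((2 ^ (n + 1) : ℕ) : ℤ) ↔ m ≤ j) ∧
          (∀ j : ℕ, ((2 ^ j : ℕ) : ℤ) • y ∈
              (W.baseChange K).torsionLocalKer (v.adicCompletion K) ((2 ^ (n + 1) : ℕ) : ℤ) ↔ κ ≤ j) := by
  have hmM : m ≤ n + 1 := le_of_addOrderOf_galH1Torsion_eq_two_pow (W.baseChange K) hx
  have hκM : κ ≤ n + 1 := le_of_addOrderOf_galH1Torsion_eq_two_pow (W.baseChange K) hy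
  -- `2^{ord} • class = 0`
  have hex : ((2 : ℤ) ^ m) • x = 0 := by
    have h := addOrderOf_dvd_iff_zsmul_eq_zero.mp (show (addOrderOf x : ℤ) ∣ (2 : ℤ) ^ m by rw [hx]; push_cast; exact dvd_rfl)
    exact h
  have hey : ((2 : ℤ) ^ κ) • y = 0 := by
    have h := addOrderOf_dvd_iff_zsmul_eq_zero.mp (show (addOrderOf y : ℤ) ∣ (2 : ℤ) ^ κ by rw [hy]; push_cast; exact dvd_rfl)
    exact h
  by_cases hsoc : 2 ^ (m - 1) • x = 2 ^ (κ - 1) • y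
  · -- ### equal socles: the single class `x` (r = 1); the common socle transports full order to `y`
    obtain ⟨ρ, hsq, hμ, ⟨P, hPp, hPm⟩, -, -, ℓ, hbℓ, hℓ, hℓN, hℓD, hℓ2, hprime, hfrob, hdvd1, hdvd2, hloc⟩ :=
      exists_regular_kolyvaginPrime_of_heegner_signed (W := W) (N := N) hCheb hK hodd hH n hρ2 hsurj hc₀ hc (r := 1) ![x] (sgn := ![sx])
        (fun i ↦ by fin_cases i; exact hsx) (fun i ↦ by fin_cases i; exact hτx) ![m]
        (fun i ↦ by fin_cases i; exact hex)
        (fun a ha i ↦ by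
          fin_cases i
          simp only [Fin.sum_univ_one, Fin.isValue, Matrix.cons_val_zero] at ha
          have h := addOrderOf_dvd_iff_zsmul_eq_zero.mpr ha
          rw [hx] at h
          simpa using h)
        (fun a ha ↦ by
          simp only [Fin.sum_univ_one, Fin.isValue, Matrix.cons_val_zero] at ha ⊢
          have h := hres (a 0) 0 (fun ρ hρ' ↦ by rw [zero_smul, add_zero]; exact ha ρ hρ')
          rwa [zero_smul, add_zero] at h)
        ![m] (fun i ↦ by fin_cases i; exact le_rfl) (fun i ↦ by fin_cases i; exact hmM) b
    refine ⟨ρ, hsq, hμ, ⟨P, hPp, hPm⟩, ℓ, hbℓ, hℓ, hℓN, hℓD, hℓ2, hprime, hfrob, hdvd1, hdvd2, fun v hv ↦ ?_⟩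
    have hxv : ∀ j : ℕ, ((2 ^ j : ℕ) : ℤ) • x ∈
        (W.baseChange K).torsionLocalKer (v.adicCompletion K) ((2 ^ (n + 1) : ℕ) : ℤ) ↔ m ≤ j := fun j ↦
      pow_zsmul_mem_iff_of_output _ hm hx (by simpa using hloc 0 v hv) j
    refine ⟨hxv, pow_zsmul_mem_iff_of_socle_not_mem _ hκ hy ?_⟩
    -- the common socle is `2^{m-1} • x`, and `m ≤ m - 1` fails
    rw [natCast_zsmul, ← hsoc, ← natCast_zsmul]
    intro hmem
    have := (hxv (m - 1)).mp hmem
    omega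
  · -- ### distinct socles: the independent pair `{x, y}` (r = 2)
    have hord : ∀ i : Fin 2, addOrderOf (![x, y] i) = 2 ^ (![m, κ] : Fin 2 → ℕ) i := fun i ↦ by
      fin_cases i
      · exact hx
      · exact hy
    obtain ⟨ρ, hsq, hμ, ⟨P, hPp, hPm⟩, -, -, ℓ, hbℓ, hℓ, hℓN, hℓD, hℓ2, hprime, hfrob, hdvd1, hdvd2, hloc⟩ :=
      exists_regular_kolyvaginPrime_of_heegner_signed (W := W) (N := N) hCheb hK hodd hH n hρ2 hsurj hc₀ hc (r := 2) ![x, y] (sgn := ![sx, sy])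
        (fun i ↦ by fin_cases i <;> assumption) (fun i ↦ by fin_cases i <;> assumption) ![m, κ]
        (fun i ↦ by fin_cases i <;> assumption)
        (fun a ha i ↦ by
          simp only [Fin.sum_univ_two, Fin.isValue, Matrix.cons_val_zero, Matrix.cons_val_one] at ha
          obtain ⟨h0, h1⟩ := dvd_of_zsmul_add_zsmul_eq_zero_of_socle_ne hm hκ hx hy hsoc ha
          fin_cases i
          · simpa using h0
          · simpa using h1)
        (fun a ha ↦ by
          simp only [Fin.sum_univ_two, Fin.isValue, Matrix.cons_val_zero, Matrix.cons_val_one] at ha ⊢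
          exact hres (a 0) (a 1) ha)
        ![m, κ] (fun i ↦ by fin_cases i <;> exact le_rfl) (fun i ↦ by fin_cases i <;> assumption) b
    refine ⟨ρ, hsq, hμ, ⟨P, hPp, hPm⟩, ℓ, hbℓ, hℓ, hℓN, hℓD, hℓ2, hprime, hfrob, hdvd1, hdvd2, fun v hv ↦ ⟨fun j ↦ ?_, fun j ↦ ?_⟩⟩
    · exact pow_zsmul_mem_iff_of_output _ hm hx (by simpa using hloc 0 v hv) j
    · exact pow_zsmul_mem_iff_of_output _ hκ hy (by simpa using hloc 1 v hv) j

end Summit.BirchSwinnertonDyer.BirchSwinnertonDyer.Theorems.GenusExact.RegularSigned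

end
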